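import Literature.ModelTheory.ExponentialFields.NewtonTransfer
import Literature.ModelTheory.ExponentialFields.ExpPolyCodeDeriv
import Literature.ModelTheory.ExponentialFields.OrderedExpFieldModels
import HarnessLib

/-!
# The Newton scheme of flat exponential systems: truth in `ℝ_exp` and use in models of `OEF`

Family `periods` (periods.S27), topic `Literature/ModelTheory/ExponentialFields`: node (B7″) of the
decomposition of the conditional half of Macintyre–Wilkie's theorem
(`Literature.ModelTheory.ExponentialFields.macintyreWilkie_existential_of_schanuelProperty`).

For a square system of *integer exponential polynomials* presented by monomial codes
(`F : List ExpPolyCode` in `n` unknowns, `LastRootConjecture.lean`), the **code Newton sentence**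
`codeNewtonSentence n F` is the Newton sentence `NK_{F,G,H}` (`NewtonSentences.lean`) of the row
terms `rowTerm n F i` with the Jacobian entries `G` and second derivatives `H` given by the
*code* derivatives (`ExpPolyCodeDeriv.lean`).  This file proves:

* `ExpPolyCode.real_models_codeNewtonSentence` : `ℝ ⊨ codeNewtonSentence n F` (so the **Newton
  scheme** `newtonScheme = {codeNewtonSentence n F | n, F}` is a set of sentences true in `ℝ_exp`,
  `newtonScheme_subset_realExpTheory`);
* `ExpPolyCode.exists_zero_of_isNonsingularZero` : if `F` has a non-singular zero in `ℝⁿ`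
  (`ExpPolyCode.IsNonsingularZero`), then in every model `K` of a theory proving `OEF`
  (`OrderedExpFieldModels.lean`) which satisfies `codeNewtonSentence n F`, the rows of `F` have a
  common zero in `Kⁿ` — Jones–Servi 2011, Thm. 3.7 ("Suppose that `ℝ^α ⊨ ∃x̄ ∈ V^{reg}(F)`. Then
  `T ⊢ ∃x̄ ∈ V^{reg}(F)`") for `exp`, with `T ⊇ OEF ∪ {codeNewtonSentence n F}` and the weaker
  (sufficient) conclusion `T ⊢ ∃x̄ F(x̄) = 0`.

## References

* G. O. Jones, T. Servi, *On the decidability of the real field with a generic power function*,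
  J. Symb. Log. 76 (2011), Thm. 3.7.
* A. Macintyre, A. J. Wilkie, *On the decidability of the real exponential field* (1996), §4.
-/

noncomputable section

open FirstOrder FirstOrder.Language FirstOrder.Language.Structure
open scoped BigOperators Matrix

namespace Literature.ModelTheory.ExponentialFields

namespace ExpPolyCode

variable (n : ℕ) (F : List ExpPolyCode)

/-- **The code Newton sentence** of a square system of integer exponential polynomials: the
Newton sentence of its rows with code derivatives. [cite: JonesServi2011, Lemma 3.5 (shape of the statement)] -/
def codeNewtonSentence : Language.orderedExpRing.Sentence :=
  NewtonExp.newtonSentence (fun i => rowTerm n F i) (pdRowTerm n F) (pd2RowTerm n F)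

/-- **`ℝ ⊨ codeNewtonSentence n F`.** [cite: JonesServi2011, Lemma 3.5 (proof)] -/
theorem real_models_codeNewtonSentence : ℝ ⊨ codeNewtonSentence n F :=
  NewtonExp.real_models_newtonSentence (F := fun i => rowTerm n F i) (G := pdRowTerm n F)
    (H := pd2RowTerm n F) (jacFun_rowTerm_eq n F) (fderiv_pdRowTerm_single n F)

/-- **The Newton scheme**: all code Newton sentences. [folklore] -/
def newtonScheme : Language.orderedExpRing.Theory :=
  {σ | ∃ (n : ℕ) (F : List ExpPolyCode), σ = codeNewtonSentence n F}

/-- Membership of the code Newton sentences in the scheme. [folklore] -/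
theorem codeNewtonSentence_mem_newtonScheme : codeNewtonSentence n F ∈ newtonScheme :=
  ⟨n, F, rfl⟩

/-- The Newton scheme is true in `ℝ_exp`: `newtonScheme ⊆ Th(ℝ_exp)`. [folklore] -/
theorem newtonScheme_subset_realExpTheory : newtonScheme ⊆ realExpTheory := by
  rintro σ ⟨n, F, rfl⟩
  exact Language.mem_completeTheory.2 (real_models_codeNewtonSentence n F)

/-- `jac n F` (`LastRootConjectureProofs.lean`) is `NewtonExp.jacFun` of the rows. [folklore] -/
theorem jac_eq_jacFun (x : Fin n → ℝ) : jac n F x = NewtonExp.jacFun (fun i => rowTerm n F i) x := rfl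

/-- A non-singular zero of `F` (in the sense of `LastRootConjecture.lean`) is a zero of the row
system with invertible Jacobian. [folklore] -/
theorem sysFun_eq_zero_and_det_ne_zero_of_isNonsingularZero {a : Fin n → ℝ}
    (ha : IsNonsingularZero n F a) :
    RealExpModel.sysFun (fun i => rowTerm n F i) Empty.elim a = 0 ∧
      (NewtonExp.jacFun (fun i => rowTerm n F i) a).det ≠ 0 := by
  obtain ⟨-, hz, B, hB⟩ := (isNonsingularZero_iff n F a).1 ha
  refine ⟨funext fun i => ?_, ?_⟩
  · show (rowTerm n F i).realize (Sum.elim Empty.elim a) = 0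
    rw [realize_rowTerm]
    exact hz i
  · rw [← jac_eq_jacFun]
    exact Matrix.det_ne_zero_of_left_inverse hB

/-- **Transfer of non-singular zeros through the code Newton sentence** (Jones–Servi 2011,
Thm. 3.7, for `exp`): if `F` has a non-singular zero in `ℝⁿ`, then in every ordered field `K`
with a lawful structure, an `IsOrderedExp` exponential, and `K ⊨ codeNewtonSentence n F`, the
rows of `F` have a common zero. [cite: JonesServi2011, Thm. 3.7] -/
theorem exists_zero_of_isNonsingularZero_lawful {a : Fin n → ℝ} (ha : IsNonsingularZero n F a)
    (K : Type) [Field K] [LinearOrder K] [IsStrictOrderedRing K]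
    [Language.orderedExpRing.Structure K] [RealExpModel.LawfulStructure K] (E : K → K)
    (hE : IsOrderedExp E)
    (hexp : ∀ v : Fin 1 → K, funMap (L := Language.orderedExpRing) expRingFunc.exp v = E (v 0))
    (hNK : K ⊨ codeNewtonSentence n F) :
    ∃ x : Fin n → K, ∀ i, (rowTerm n F i).realize (Sum.elim (Empty.elim : Empty → K) x) = 0 := by
  obtain ⟨hz, hJ⟩ := sysFun_eq_zero_and_det_ne_zero_of_isNonsingularZero n F ha
  exact NewtonExp.exists_zero_of_models_newtonSentence (F := fun i => rowTerm n F i) (G := pdRowTerm n F)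
    (H := pd2RowTerm n F) (jacFun_rowTerm_eq n F) hz hJ K E hE hexp hNK

/-- **In the models of a theory proving `OEF` and containing the code Newton sentence, a
non-singular real zero gives a zero** — the form consumed by the assembly of the conditional
half (`T₀ = OEF ∪ newtonScheme`). [cite: JonesServi2011, Thm. 3.7] -/
theorem exists_zero_of_isNonsingularZero {T : Language.orderedExpRing.Theory}
    (hT : Theory.ModelsOEF T) (hNK : T ⊨ᵇ codeNewtonSentence n F) {a : Fin n → ℝ}
    (ha : IsNonsingularZero n F a) (K : Language.Theory.ModelType.{0, 0, 0} T) :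
    ∃ x : Fin n → Theory.ModelType.toOEFModel hT K,
      ∀ i, (rowTerm n F i).realize (Sum.elim (Empty.elim : Empty → Theory.ModelType.toOEFModel hT K) x) = 0 := by
  have hK : (Theory.ModelType.toOEFModel hT K) ⊨ codeNewtonSentence n F := hNK.realize_sentence K
  exact exists_zero_of_isNonsingularZero_lawful n F ha (Theory.ModelType.toOEFModel hT K) OEFModel.exp
    OEFModel.isOrderedExp_exp OEFModel.funMap_exp hK

end ExpPolyCode

end Literature.ModelTheory.ExponentialFields

end
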